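import Summits.QuantumAdvantage.QuantumAdvantage.Theorems.CubicForrelationNearExactIsExactEightDigits
import Summits.QuantumAdvantage.QuantumAdvantage.Theorems.CubicForrelationNearExactIsExactTenPartner

/-!
# Crux `CubicForrelation.NearExactIsExact` (stmt-QuantumAdvantage-14043) — type O on 8 bits above `13/16`: PARTNER RIGIDITY

Certificate seat `b2b-cforr-cert` (generation 2), rung `θ₈ = 13/16`.  HONEST FRAMING: a theorem about cubic Boolean functions on 8
bits (the finite slice `n = 8` of the crux) — NOT summit progress.

Setting: `f, g : 𝔽₂⁸ → 𝔽₂` cubic, `W_g = 8·u` with `u` ODD everywhere ("type O"), and `Φ(f,g) > 13/16`.  With `s = (−1)^f ∈ {±1}`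
(`sZ`), the BUDGET is `T := Σ_x (u − 2s)² = 2¹¹(1 − Φ) < 384` (`eow_budget`; Parseval `Σu² = 1024` and `512·Φ = Σ s·u`), while every
term is an odd square, `≥ 1`: the slack `Σ_x ((u−2s)² − 1)` is `< 128`.
* PARTNER RIGIDITY (`eow_partner`): `f = d₂ := [⌊u/4⌋ odd]`, the third binary digit of `u` (degree `≤ 4`, the landed `ed_digitTwo`):
  where `f ≠ d₂` one has `u − 2s ≡ ±3 (mod 8)` so the term is `≥ 9` (`eow_cost_mismatch`), hence `f ⊕ d₂` has `< 16 = d(RM(4,8))` ones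
  and vanishes (`bb_rmWeight_holds`).
* RESIDUE (`eow_kappa`): consequently `u − 2s ≡ c (mod 8)` with `c := 2d₁ − 1 = ±1`, `d₁ := [⌊u/2⌋ odd]` (`eow_mod_eight`), i.e.
  `u = 2s + c + 8κ` with `κ` integral; a point with `κ ≠ 0` costs `≥ 48` and one with `|κ| ≥ 2` costs `≥ 224` (`eow_cost_kappa`), so
  `|κ| ≤ 1` everywhere and `κ ≠ 0` at no more than two points.
The companion file `…EightTypeO.lean` feeds this into the Fourier identity `û = 32·(−1)^g` and kills all three cases.

References: C. Carlet, *Boolean Functions for Cryptography and Coding Theory*, CUP 2021, §4.1 (McEliece divisibility), Thm 7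
(Reed–Muller distance); S. Aaronson, A. Ambainis, *Forrelation*, SIAM J. Comput. 47 (2018) §1.1.1.  Everything below is proved from
Mathlib and the tree; axioms are the standard three.
-/

set_option linter.dupNamespace false -- D-0017: single-problem summit ⇒ `QuantumAdvantage.QuantumAdvantage` by design

noncomputable section

namespace Summit.QuantumAdvantage.QuantumAdvantage.Theorems.CubicForrelation.NearExactIsExact

open Finset
open Literature.Computability.QuantumComplexity
open Literature.Computability.QuantumComplexity.BuzetChailloux (signOf_sq)
open Literature.Computability.QuantumComplexity.DerivativeWalsh (W sum_W_sq)

/-! ### The budget -/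

/-- Parseval on 8 bits: `Σ_x W_g(x)² = 2¹⁶`. [folklore] -/
theorem eow_parseval (g : (Fin (4 + 4) → Bool) → Bool) : ∑ x, W (fun y => signOf (g y)) x ^ 2 = (2 : ℝ) ^ 16 := by
  rw [sum_W_sq, sum_congr rfl fun y _ => signOf_sq (g y), sum_const, card_univ, Fintype.card_fun, Fintype.card_bool,
    Fintype.card_fin]
  norm_num

/-- **The budget identity on 8 bits.** With `W_g = 8u` and `s = (−1)^f`: `Σ_x (u − 2s)² = 2¹¹·(1 − Φ(f,g))`. [this work] -/
theorem eow_budget (f g : (Fin (4 + 4) → Bool) → Bool) (u : (Fin (4 + 4) → Bool) → ℤ)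
    (hu : ∀ x, W (fun y => signOf (g y)) x = (2 : ℝ) ^ 3 * (u x : ℝ)) :
    ((∑ x, (u x - 2 * sZ (f x)) ^ 2 : ℤ) : ℝ) = (2 : ℝ) ^ 11 * (1 - forrelation f g) := by
  have hP := eow_parseval g
  have hΦ := vg_two_pow_mul_forrelation f g
  have e : ∀ x : Fin (4 + 4) → Bool, ((u x : ℝ) - 2 * (sZ (f x) : ℝ)) ^ 2 =
      W (fun y => signOf (g y)) x ^ 2 / 64 - signOf (f x) * W (fun y => signOf (g y)) x / 2 + 4 := by
    intro x
    have hux : (u x : ℝ) = W (fun y => signOf (g y)) x / 8 := by rw [hu x]; ring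
    have hs2 : signOf (f x) ^ 2 = 1 := signOf_sq _
    rw [tp_sZ_cast, hux]
    nlinarith [hs2]
  push_cast
  rw [sum_congr rfl fun x _ => e x, sum_add_distrib, sum_sub_distrib, ← sum_div, ← sum_div, hP, ← hΦ, sum_const,
    card_univ, Fintype.card_fun, Fintype.card_bool, Fintype.card_fin]
  norm_num
  ring

/-- In the window `Φ > 13/16` the budget is `< 384`. [this work] -/
theorem eow_budget_lt (f g : (Fin (4 + 4) → Bool) → Bool) (u : (Fin (4 + 4) → Bool) → ℤ)
    (hu : ∀ x, W (fun y => signOf (g y)) x = (2 : ℝ) ^ 3 * (u x : ℝ)) (hΦ : 13 / 16 < forrelation f g) :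
    (∑ x, (u x - 2 * sZ (f x)) ^ 2 : ℤ) < 384 := by
  have h := eow_budget f g u hu
  have h' : ((∑ x, (u x - 2 * sZ (f x)) ^ 2 : ℤ) : ℝ) < 384 := by rw [h]; linarith
  exact_mod_cast h'

/-! ### Partner rigidity: `f` is the third binary digit of `u` -/

/-- Pointwise: for odd `a` and `s = (−1)^b`, if `b ≠ [⌊a/4⌋ odd]` then `a − 2s ≡ ±3 (mod 8)`, so `(a − 2s)² ≥ 9`. [this work] -/
theorem eow_cost_mismatch (a : ℤ) (b : Bool) (ha : Odd a) (hne : b ≠ decide (Odd (a / 2 / 2))) :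
    9 ≤ (a - 2 * sZ b) ^ 2 := by
  have h0 := td_two_mul_div_add a
  have h1 := td_two_mul_div_add (a / 2)
  have h2 := td_two_mul_div_add (a / 2 / 2)
  rw [if_pos ha] at h0
  have key : a - 2 * sZ b ≤ -3 ∨ 3 ≤ a - 2 * sZ b := by
    cases b <;> by_cases hq : Odd (a / 2 / 2) <;> by_cases hp : Odd (a / 2) <;>
      simp only [hq, hp, decide_true, decide_false, ne_eq, not_true_eq_false, Bool.false_eq_true, Bool.true_eq_false,
        not_false_eq_true, if_true, if_false] at hne h1 h2 ⊢ <;> simp only [sZ, if_true, if_false, Bool.false_eq_true] <;> omega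
  exact tp_sq_ge (k := 3) (by norm_num) key

/-- **Partner rigidity in type O.** For cubic `f, g` on 8 bits with `W_g = 8u`, `u` odd everywhere and `Φ(f,g) > 13/16`:
`f(x) = [⌊u(x)/4⌋ odd]` for every `x` (the mismatch set is the support of a degree-`≤ 4` function with `< 16` ones). [this work] -/
theorem eow_partner (f g : (Fin (4 + 4) → Bool) → Bool) (hf : IsDegLeFun 3 f) (hg : IsDegLeFun 3 g)
    (u : (Fin (4 + 4) → Bool) → ℤ) (hu : ∀ x, W (fun y => signOf (g y)) x = (2 : ℝ) ^ 3 * (u x : ℝ))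
    (hodd : ∀ x, Odd (u x)) (hΦ : 13 / 16 < forrelation f g) :
    ∀ x, f x = decide (Odd (u x / 2 / 2)) := by
  have hT := eow_budget_lt f g u hu hΦ
  -- the mismatch function has degree ≤ 4
  have he : IsDegLeFun 4 (fun x => f x ^^ decide (Odd (u x / 2 / 2))) :=
    bb_isDegLeFun_bxor (hf.mono (by norm_num)) (ed_digitTwo g u hg hu)
  -- cost accounting: `Σ (u−2s)² ≥ 256 + 8·#mismatch`
  have hpt : ∀ x, (1 : ℤ) + 8 * (if (f x ^^ decide (Odd (u x / 2 / 2))) = true then 1 else 0) ≤ (u x - 2 * sZ (f x)) ^ 2 := by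
    intro x
    split_ifs with h
    · have hne : f x ≠ decide (Odd (u x / 2 / 2)) := by
        intro he'; rw [he', Bool.xor_self] at h; exact Bool.false_ne_true h
      have := eow_cost_mismatch (u x) (f x) (hodd x) hne
      linarith
    · have := tp_res_sq_ge_one (tp_sZ_cases (f x)) (hodd x)
      linarith
  have hsum := sum_le_sum fun x (_ : x ∈ (univ : Finset (Fin (4 + 4) → Bool))) => hpt x
  rw [sum_add_distrib, ← mul_sum, sum_boole] at hsum
  have h256 : ∑ x : Fin (4 + 4) → Bool, (1 : ℤ) = 256 := by simp
  rw [h256] at hsum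
  -- fewer than 16 ones ⇒ identically zero (Reed–Muller distance, `d = 4`, `m = 8`)
  have hzero : ∀ x, (f x ^^ decide (Odd (u x / 2 / 2))) = false := by
    intro x
    by_contra hx
    rw [Bool.not_eq_false] at hx
    have h := bb_rmWeight_holds (4 + 4) 4 _ he ⟨x, hx⟩
    have h16 : (16 : ℤ) ≤ #(univ.filter fun x : Fin (4 + 4) → Bool => (f x ^^ decide (Odd (u x / 2 / 2))) = true) := by
      have h' : 16 ≤ #(univ.filter fun x : Fin (4 + 4) → Bool => (f x ^^ decide (Odd (u x / 2 / 2))) = true) := by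
        rw [show (2 : ℕ) ^ (4 + 4) = 256 from by norm_num, show (2 : ℕ) ^ 4 = 16 from by norm_num] at h; omega
      exact_mod_cast h'
    push_cast at hsum
    linarith
  intro x
  have h := hzero x
  revert h
  cases f x <;> cases decide (Odd (u x / 2 / 2)) <;> decide

/-! ### The residue `κ` -/

/-- With `f = d₂`: `u − 2s ≡ 2d₁ − 1 (mod 8)` pointwise (`u ≡ 1 + 2d₁ + 4d₂ (mod 8)`, `s = 1 − 2d₂`). [this work] -/
theorem eow_mod_eight (a : ℤ) (b : Bool) (ha : Odd a) (hb : b = decide (Odd (a / 2 / 2))) :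
    (8 : ℤ) ∣ (a - 2 * sZ b) - (if Odd (a / 2) then 1 else -1) := by
  obtain ⟨q, hq⟩ := td_mod_eight a
  rw [if_pos ha] at hq
  subst hb
  by_cases h1 : Odd (a / 2) <;> by_cases h2 : Odd (a / 2 / 2) <;>
    simp only [h1, h2, if_true, if_false, decide_true, decide_false, sZ, Bool.false_eq_true] at hq ⊢ <;> omega

/-- Cost of a residue: for `c = ±1` and integer `κ`, `(c + 8κ)² − 1 ≥ 0`, `≥ 48` if `κ ≠ 0`, and `≥ 224` if `|κ| ≥ 2`. [this work] -/
theorem eow_cost_kappa (c κ : ℤ) (hc : c = 1 ∨ c = -1) :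
    0 ≤ (c + 8 * κ) ^ 2 - 1 ∧ (κ ≠ 0 → 48 ≤ (c + 8 * κ) ^ 2 - 1) ∧ (κ ≤ -2 ∨ 2 ≤ κ → 224 ≤ (c + 8 * κ) ^ 2 - 1) := by
  refine ⟨?_, fun hk => ?_, fun hk => ?_⟩
  · have hk3 : κ ≤ -1 ∨ κ = 0 ∨ 1 ≤ κ := by omega
    rcases hc with rfl | rfl <;> rcases hk3 with hk | rfl | hk <;> nlinarith
  · have hk' : κ ≤ -1 ∨ 1 ≤ κ := by omega
    rcases hc with rfl | rfl <;> rcases hk' with hk' | hk' <;> nlinarith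
  · rcases hc with rfl | rfl <;> rcases hk with hk | hk <;> nlinarith

/-- **The residue structure in type O.** For cubic `f, g` on 8 bits with `W_g = 8u`, `u` odd everywhere and `Φ(f,g) > 13/16`
there is an integer function `κ` with `u = 2s + c + 8κ` pointwise (`s = (−1)^f`, `c = 2[⌊u/2⌋ odd] − 1`), `κ ∈ {0, ±1}` everywhere,
and `κ ≠ 0` at no more than two points. [this work] -/
theorem eow_kappa (f g : (Fin (4 + 4) → Bool) → Bool) (hf : IsDegLeFun 3 f) (hg : IsDegLeFun 3 g)
    (u : (Fin (4 + 4) → Bool) → ℤ) (hu : ∀ x, W (fun y => signOf (g y)) x = (2 : ℝ) ^ 3 * (u x : ℝ))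
    (hodd : ∀ x, Odd (u x)) (hΦ : 13 / 16 < forrelation f g) :
    ∃ κ : (Fin (4 + 4) → Bool) → ℤ,
      (∀ x, u x = 2 * sZ (f x) + (if Odd (u x / 2) then 1 else -1) + 8 * κ x) ∧
      (∀ x, κ x = 0 ∨ κ x = 1 ∨ κ x = -1) ∧
      #(univ.filter fun x => κ x ≠ 0) ≤ 2 := by
  have hT := eow_budget_lt f g u hu hΦ
  have hfd := eow_partner f g hf hg u hu hodd hΦ
  have h8 := fun x => eow_mod_eight (u x) (f x) (hodd x) (hfd x)
  choose κ hκ using h8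
  have hu' : ∀ x, u x = 2 * sZ (f x) + (if Odd (u x / 2) then 1 else -1) + 8 * κ x := fun x => by
    have := hκ x; omega
  have hc : ∀ x, (if Odd (u x / 2) then (1 : ℤ) else -1) = 1 ∨ (if Odd (u x / 2) then (1 : ℤ) else -1) = -1 := fun x => by
    split_ifs <;> simp
  -- the slack sum
  have hslack : ∑ x, (((if Odd (u x / 2) then (1 : ℤ) else -1) + 8 * κ x) ^ 2 - 1) < 128 := by
    have e : ∀ x, (u x - 2 * sZ (f x)) ^ 2 = (((if Odd (u x / 2) then (1 : ℤ) else -1) + 8 * κ x) ^ 2 - 1) + 1 := by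
      intro x
      have e1 : u x - 2 * sZ (f x) = (if Odd (u x / 2) then (1 : ℤ) else -1) + 8 * κ x := by linarith [hκ x]
      rw [e1]; ring
    rw [sum_congr rfl fun x _ => e x, sum_add_distrib] at hT
    have h256 : ∑ x : Fin (4 + 4) → Bool, (1 : ℤ) = 256 := by simp
    rw [h256] at hT
    linarith
  have hnn : ∀ x ∈ (univ : Finset (Fin (4 + 4) → Bool)),
      0 ≤ ((if Odd (u x / 2) then (1 : ℤ) else -1) + 8 * κ x) ^ 2 - 1 := fun x _ => (eow_cost_kappa _ (κ x) (hc x)).1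
  refine ⟨κ, hu', fun x => ?_, ?_⟩
  · by_contra hne
    push Not at hne
    have hbig : κ x ≤ -2 ∨ 2 ≤ κ x := by omega
    have h224 := (eow_cost_kappa _ (κ x) (hc x)).2.2 hbig
    have := single_le_sum hnn (mem_univ x)
    linarith
  · by_contra hgt
    push Not at hgt
    have h48 : ∀ x ∈ univ.filter (fun x => κ x ≠ 0),
        (48 : ℤ) ≤ ((if Odd (u x / 2) then (1 : ℤ) else -1) + 8 * κ x) ^ 2 - 1 :=
      fun x hx => (eow_cost_kappa _ (κ x) (hc x)).2.1 (mem_filter.1 hx).2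
    have hle := sum_le_sum h48
    rw [sum_const, nsmul_eq_mul] at hle
    have hsub := sum_le_sum_of_subset_of_nonneg (filter_subset (fun x => κ x ≠ 0) univ)
      (fun x _ _ => hnn x (mem_univ x))
    have : (3 : ℤ) * 48 ≤ #(univ.filter fun x => κ x ≠ 0) * 48 := by
      have : (3 : ℤ) ≤ #(univ.filter fun x => κ x ≠ 0) := by exact_mod_cast hgt
      linarith
    linarith

end Summit.QuantumAdvantage.QuantumAdvantage.Theorems.CubicForrelation.NearExactIsExact

end
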